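import Summits.KontsevichZagierPeriods.KontsevichZagierPeriods.Theorems.GpcLegendreLemniscatic.Negative.Canonical
import Literature.Probability.RandomPlanarGeometry.EllipticKBasic
import Literature.NumberTheory.Transcendental.KontsevichZagierGammaProofs

/-!
# `GpcLegendreLemniscatic` (stmt-KontsevichZagierPeriods-0280) — negative knowledge, part 3: refuted strengthenings

Support file for the crux `Grothendieck.GpcLegendreLemniscatic` (cdisprove seat, gen 1), on top of
part 1 (`Canonical`). Contents: (§4.1) NO TERMWISE TRANSFER — neither `[k]·[k]` (value `K²`) nor
`[e]·[k]` (value `EK`) is equivalent to a rational multiple `[ℝ, q/(1+x²)]` of `π`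
(`not_equivalent_kk_ratArctan`, `not_equivalent_ek_ratArctan`; Chudnovsky's theorem
`algebraicIndependent_real_pi_gamma_one_quarter` and Lawden (4.3.6), both tree theorems), so a
derivation must mix the `E`- and `K`-parts before descending in dimension; (§4.2) the CM point is
load-bearing — the crux's shape at parameter `m`, `LegendreShape m` (`legendreShape_half_iff :
LegendreShape ½ ↔ crux`), is false at `m = 0` (`not_legendreShape_zero`, value `(π/2)² ≠ π/2`).
[cite: Chudnovsky1984, Ch. 7 §2 Corollary 2.3 (p. 307)]
-/

noncomputable section

open MeasureTheory Set
open Literature.NumberTheory.Transcendental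
open Literature.NumberTheory.Transcendental.KZ
open Literature.ModelTheory.ExponentialFields (IsSemialgebraic)
open MvPolynomial (aeval X C)
open Summit.KontsevichZagierPeriods.KontsevichZagierPeriods.Theses.Grothendieck (GpcLegendreLemniscatic)

namespace Summit.KontsevichZagierPeriods.Grothendieck.GpcLegendreLemniscaticNegative

/-! ## §4 Refuted strengthenings / natural variants

* §4.1 NO TERMWISE TRANSFER. `r₀ = 2[e ⊗ k] − [k ⊗ k]` modulo integrand additivity, but neither
  summand is separately equivalent to a rational multiple of `[ℝ, 1/(1+x²)]`: their values `2EK`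
  and `K²` are not in `ℚπ` (Chudnovsky: `π`, `Γ(¼)` algebraically independent — tree theorem
  `algebraicIndependent_real_pi_gamma_one_quarter` — and `K = Γ(¼)²/(4√π)`, tree theorem
  `Lawden1989_eq_4_3_6_holds`). So a derivation must MIX the `E`- and `K`-parts before descending
  in dimension (the planned chain does: `2e − k = g` is combined pointwise, and the exact term
  `F′(x₀)/√(1−x₁⁴)` that is split off has value `0`). More generally the only `ℚ`-relations
  `a·EK + b·K² = q·π` are the multiples of Legendre's `(a, b, q) = (2, −1, ½)` (same computation).
* §4.2 THE SELF-DUAL MODULUS IS LOAD-BEARING. The same shape at parameter `m = k²`,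
  `LegendreShape m` (`2e_m(x₀)k_m(x₁) − k_m(x₀)k_m(x₁)` against `[ℝ, 1/(2(1+x²))]`), is the crux at
  `m = ½` (`legendreShape_half_iff`) and is FALSE at `m = 0` (`not_legendreShape_zero`: value
  `(π/2)² ≠ π/2`). By value it is false at every `m ∈ [0,1) ∖ {½}`: `m ↦ 2E_mK_m − K_m²` is strictly
  decreasing (`d/dm = E(E − K)/(m(1 − m)) < 0`; route ZeroPortrait items 12735
  `LegendrePencilStrictAnti` / 11726 `PencilPortrait`, tree `LegendreRelation.hasDerivAt_Kt/Et`),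
  from `π²/4` at `m = 0` to `−∞` at `m → 1`; and it is VACUOUSLY TRUE at `m = 1` (`k₁ = 1/(1−t²)`
  is not integrable, so no admissible `r` exists). Only the CM point `m = ½` (where `K′ = K`,
  `E′ = E` turn Legendre's `EK′ + E′K − KK′ = π/2` into a relation inside `ℤ[K, E, π]`) is a
  non-vacuous true instance — consistent with the sector philosophy of the route. -/

/-- `[ℝ, q/(1+x²)]`, value `q·π`. [folklore] -/
def ratArctanRep (q : ℚ) : IntegralRep 1 where
  domain := univ
  integrand := fun x => (q : ℝ) / (1 + x 0 ^ 2)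
  isSemialgebraic_domain := Literature.ModelTheory.ExponentialFields.isSemialgebraic_univ
  isSemialgebraicFunOn_integrand := by
    have hu : IsSemialgebraic ℚ (univ : Set (Fin 1 → ℝ)) :=
      Literature.ModelTheory.ExponentialFields.isSemialgebraic_univ
    have h := isSemialgebraicFunOn_aeval_div_aeval hu
      (C q : MvPolynomial (Fin 1) ℚ) (1 + X 0 ^ 2) (fun x _ => by
        simp only [map_add, map_one, map_pow, MvPolynomial.aeval_X]
        positivity)
    exact h.congr fun x _ => by
      simp only [map_add, map_one, map_pow, MvPolynomial.aeval_X, MvPolynomial.aeval_C, eq_ratCast]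
  integrableOn := by
    rw [integrableOn_univ]
    have hg : Integrable (fun t : ℝ => (q : ℝ) / (1 + t ^ 2)) := by
      have := integrable_inv_one_add_sq.const_mul (q : ℝ)
      refine this.congr (Filter.Eventually.of_forall fun t => ?_)
      simp only [div_eq_mul_inv]
    exact ((volume_preserving_funUnique (Fin 1) ℝ).integrable_comp_emb
      (MeasurableEquiv.measurableEmbedding _)).mpr hg

/-- `value [ℝ, q/(1+x²)] = q·π`. [folklore] -/
theorem ratArctanRep_value (q : ℚ) : (ratArctanRep q).value = q * Real.pi := by
  rw [IntegralRep.value, show (ratArctanRep q).domain = univ from rfl, Measure.restrict_univ,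
    show (ratArctanRep q).integrand = fun x => (q : ℝ) / (1 + x 0 ^ 2) from rfl]
  have h := (volume_preserving_funUnique (Fin 1) ℝ).integral_comp'
    (fun t : ℝ => (q : ℝ) / (1 + t ^ 2))
  simp only [MeasurableEquiv.funUnique] at h
  have h2 : ∫ t : ℝ, (q : ℝ) / (1 + t ^ 2) = q * Real.pi := by
    have : (fun t : ℝ => (q : ℝ) / (1 + t ^ 2)) = fun t => (q : ℝ) * (1 + t ^ 2)⁻¹ := by
      ext t
      simp only [div_eq_mul_inv]
    rw [this, integral_const_mul, integral_univ_inv_one_add_sq]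
  rw [← h2, ← h]
  rfl

/-- `[k] · [k] = [(0,1)², k(x₀)k(x₁)]`, value `K²`. [folklore] -/
def kkRep : IntegralRep 2 := kRep.prod kRep

/-- `[e] · [k] = [(0,1)², e(x₀)k(x₁)]`, value `EK`. [folklore] -/
def ekRep : IntegralRep 2 := eRep.prod kRep

/-- `value ([k]·[k]) = K²`. [folklore] -/
theorem kkRep_value : kkRep.value = Literature.Analysis.SpecialFunctions.lemniscaticK ^ 2 := by
  rw [show kkRep = kRep.prod kRep from rfl, IntegralRep.value_prod, kRep_value, sq]

/-- `value ([e]·[k]) = EK`. [folklore] -/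
theorem ekRep_value : ekRep.value =
    Literature.Analysis.SpecialFunctions.lemniscaticE * Literature.Analysis.SpecialFunctions.lemniscaticK := by
  rw [show ekRep = eRep.prod kRep from rfl, IntegralRep.value_prod, kRep_value, eRep_value]

/-- `K(1/√2)² = Γ(¼)⁴/(16π)` (from Lawden (4.3.6), tree theorem). [cite: Lawden1989, §4.3 eq. (4.3.6)] -/
theorem lemniscaticK_sq :
    Literature.Analysis.SpecialFunctions.lemniscaticK ^ 2 = Real.Gamma (1 / 4) ^ 4 / (16 * Real.pi) := by
  have h := Literature.Analysis.SpecialFunctions.Lawden1989_eq_4_3_6_holds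
  unfold Literature.Analysis.SpecialFunctions.Lawden1989_eq_4_3_6 at h
  rw [h, div_pow, mul_pow, ← pow_mul, Real.sq_sqrt Real.pi_pos.le]
  norm_num

/-- **Chudnovsky, in the form used here**: `Γ(¼)⁴ ≠ c·π²` for every rational `c` (from the tree
theorem `algebraicIndependent_real_pi_gamma_one_quarter`). [cite: Chudnovsky1984, Ch. 7 §2 Corollary 2.3 (p. 307)] -/
theorem gamma_quarter_pow_four_ne_rat_mul_pi_sq (c : ℚ) :
    Real.Gamma (1 / 4) ^ 4 ≠ c * Real.pi ^ 2 := by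
  intro hc
  have hind := algebraicIndependent_real_pi_gamma_one_quarter
  rw [algebraicIndependent_iff] at hind
  have hP := hind (X 1 ^ 4 - C c * X 0 ^ 2) (by
    simp only [map_sub, map_mul, map_pow, MvPolynomial.aeval_X, MvPolynomial.aeval_C, eq_ratCast,
      Matrix.cons_val_one, Matrix.cons_val_zero, Matrix.cons_val_fin_one]
    rw [hc]
    ring)
  have h01 := congrArg (MvPolynomial.aeval ![(0 : ℝ), 1]) hP
  simp at h01

/-- **§4.1a `[k]·[k]` is not transferable alone**: for no rational `q` is `[(0,1)², k(x₀)k(x₁)]`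
equivalent to `[ℝ, q/(1+x²)]` (`K² = qπ` would give `Γ(¼)⁴ = 16q·π²`). [folklore] -/
theorem not_equivalent_kk_ratArctan (q : ℚ) : ¬ Equivalent kkRep (ratArctanRep q) := by
  intro h
  have hv := Equivalent.value_eq_holds h
  rw [kkRep_value, ratArctanRep_value, lemniscaticK_sq] at hv
  apply gamma_quarter_pow_four_ne_rat_mul_pi_sq (16 * q)
  have hπ := Real.pi_pos
  field_simp at hv
  push_cast
  linear_combination hv

/-- **§4.1b `[e]·[k]` is not transferable alone**: for no rational `q` is `[(0,1)², e(x₀)k(x₁)]`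
equivalent to `[ℝ, q/(1+x²)]` (`EK = qπ` with `4EK = 2K² + π` would give `Γ(¼)⁴ = (32q − 8)π²`). [folklore] -/
theorem not_equivalent_ek_ratArctan (q : ℚ) : ¬ Equivalent ekRep (ratArctanRep q) := by
  intro h
  have hv := Equivalent.value_eq_holds h
  rw [ekRep_value, ratArctanRep_value] at hv
  have hL := Literature.Analysis.SpecialFunctions.Lawden1989_eq_3_8_29_lemniscatic_holds
  unfold Literature.Analysis.SpecialFunctions.Lawden1989_eq_3_8_29_lemniscatic at hL
  have hK2 := lemniscaticK_sq
  apply gamma_quarter_pow_four_ne_rat_mul_pi_sq (32 * q - 8)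
  have hπ := Real.pi_pos
  -- `2EK − K² = π/2`, `EK = qπ` ⇒ `K² = 2qπ − π/2` ⇒ `Γ⁴/(16π) = (2q − ½)π`
  have hK : Literature.Analysis.SpecialFunctions.lemniscaticK ^ 2 = (2 * q - 1 / 2) * Real.pi := by
    linear_combination 2 * hv - hL
  rw [hK] at hK2
  field_simp at hK2
  push_cast
  linear_combination (-1 / 2 : ℝ) * hK2

/-- The domain of a product of two unit-interval representations is `(0,1)²`. [folklore] -/
theorem prod_unitRep_domain (f g : ℝ → ℝ) (hf : IsSemialgebraicFunOn ℚ unitIoo (fun x => f (x 0)))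
    (hfi : IntegrableOn f (Ioo 0 1)) (hg : IsSemialgebraicFunOn ℚ unitIoo (fun x => g (x 0)))
    (hgi : IntegrableOn g (Ioo 0 1)) : ((unitRep f hf hfi).prod (unitRep g hg hgi)).domain = unitSq := by
  ext x
  change x 0 ∈ Ioo (0:ℝ) 1 ∧ x 1 ∈ Ioo (0:ℝ) 1 ↔ _
  simp [unitSq, Fin.forall_fin_two]

/-- The integrand of a product of two unit-interval representations is `f(x₀)g(x₁)`. [folklore] -/
theorem prod_unitRep_integrand_apply (f g : ℝ → ℝ) (hf : IsSemialgebraicFunOn ℚ unitIoo (fun x => f (x 0)))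
    (hfi : IntegrableOn f (Ioo 0 1)) (hg : IsSemialgebraicFunOn ℚ unitIoo (fun x => g (x 0)))
    (hgi : IntegrableOn g (Ioo 0 1)) (x : Fin 2 → ℝ) :
    ((unitRep f hf hfi).prod (unitRep g hg hgi)).integrand x = f (x 0) * g (x 1) := by
  rw [IntegralRep.prod_integrand_eq]
  rfl

/-- The crux's shape at parameter `m = k²` (self-dual form `2e_m k_m − k_m k_m`, same right side;
a route-item VARIANT, not a cited fact). -/
def LegendreShape (m : ℝ) : Prop :=
  ∀ (r : IntegralRep 2) (r' : IntegralRep 1), r.domain = unitSq →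
    EqOn r.integrand (fun x => 2 * Real.sqrt (1 - m * x 0 ^ 2) / Real.sqrt (1 - x 0 ^ 2) /
        Real.sqrt ((1 - x 1 ^ 2) * (1 - m * x 1 ^ 2)) -
      1 / Real.sqrt ((1 - x 0 ^ 2) * (1 - m * x 0 ^ 2)) / Real.sqrt ((1 - x 1 ^ 2) * (1 - m * x 1 ^ 2)))
      r.domain →
    r'.domain = univ → EqOn r'.integrand (fun x => 1 / (2 * (1 + x 0 ^ 2))) r'.domain → Equivalent r r'

/-- At `m = ½` the shape is the crux (syntactic variant `½·x²` of `x²/2`). [folklore] -/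
theorem legendreShape_half_iff : LegendreShape (1 / 2) ↔ GpcLegendreLemniscatic := by
  have hfun : (fun x : Fin 2 → ℝ => 2 * Real.sqrt (1 - 1 / 2 * x 0 ^ 2) / Real.sqrt (1 - x 0 ^ 2) /
        Real.sqrt ((1 - x 1 ^ 2) * (1 - 1 / 2 * x 1 ^ 2)) -
      1 / Real.sqrt ((1 - x 0 ^ 2) * (1 - 1 / 2 * x 0 ^ 2)) / Real.sqrt ((1 - x 1 ^ 2) * (1 - 1 / 2 * x 1 ^ 2))) =
      cruxIntegrand := by
    funext x
    simp only [cruxIntegrand]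
    ring_nf
  unfold LegendreShape
  rw [hfun]
  exact Iff.rfl

/-- `a(t) = 1/√(1 − t²)`, the `K(0) = E(0) = π/2` integrand. [folklore] -/
def aFun (t : ℝ) : ℝ := 1 / Real.sqrt (1 - t ^ 2)

/-- `x ↦ a(x₀)` is semialgebraic on `unitIoo`. [folklore] -/
theorem isSemialgebraicFunOn_aFun : IsSemialgebraicFunOn ℚ unitIoo (fun x => aFun (x 0)) := by
  have hsqrt := IsSemialgebraicFunOn.sqrt_holds isSemialgebraicFunOn_one_sub_sq
  have h1 := isSemialgebraicFunOn_ratCast isSemialgebraic_unitIoo 1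
  refine ((h1.div hsqrt) fun x hx => ?_).congr fun x _ => ?_
  · exact (Real.sqrt_pos.2 (by have := hx.1; have := hx.2; nlinarith)).ne'
  · simp [aFun]

/-- `a` is the tree's elliptic integrand of parameter `0`. [folklore] -/
theorem aFun_eq_ellIntegrand (t : ℝ) :
    aFun t = Literature.Probability.RandomPlanarGeometry.ellIntegrand 0 t := by
  simp [aFun, Literature.Probability.RandomPlanarGeometry.ellIntegrand]

/-- `a` is integrable on `(0,1)`. [folklore] -/
theorem integrableOn_aFun : IntegrableOn aFun (Ioo 0 1) := by
  have h := Literature.Probability.RandomPlanarGeometry.intervalIntegrable_ellIntegrand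
    (m := 0) le_rfl (by norm_num)
  rw [intervalIntegrable_iff_integrableOn_Ioo_of_le zero_le_one] at h
  exact h.congr_fun (fun t _ => (aFun_eq_ellIntegrand t).symm) measurableSet_Ioo

/-- `[(0,1), a]`, value `K(0) = π/2`. [folklore] -/
def aRep : IntegralRep 1 := unitRep aFun isSemialgebraicFunOn_aFun integrableOn_aFun

/-- `value [(0,1), a] = π/2` (tree theorem `ellipticK_zero`). [folklore] -/
theorem aRep_value : aRep.value = Real.pi / 2 := by
  rw [aRep, unitRep_value, ← Literature.Probability.RandomPlanarGeometry.ellipticK_zero,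
    Literature.Probability.RandomPlanarGeometry.ellipticK, intervalIntegral.integral_of_le zero_le_one,
    integral_Ioc_eq_integral_Ioo]
  refine setIntegral_congr_fun measurableSet_Ioo fun t _ => ?_
  simp [aFun]

/-- **§4.2 The shape is false at `m = 0`** (witness `[a]·[a]`, value `(π/2)² ≠ π/2`): the self-dual
point `K′ = K`, `E′ = E` (`m = ½`) is load-bearing. [folklore] -/
theorem not_legendreShape_zero : ¬ LegendreShape 0 := by
  intro h
  have hE := h (aRep.prod aRep) arctanRep (prod_unitRep_domain _ _ _ _ _ _) (fun x hx => ?_) rfl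
    (fun x _ => rfl)
  · have hv := Equivalent.value_eq_holds hE
    rw [IntegralRep.value_prod, aRep_value, arctanRep_value] at hv
    have hπ := Real.pi_gt_three
    nlinarith [hv, hπ]
  · rw [show aRep.prod aRep = (unitRep aFun isSemialgebraicFunOn_aFun integrableOn_aFun).prod
      (unitRep aFun isSemialgebraicFunOn_aFun integrableOn_aFun) from rfl, prod_unitRep_integrand_apply]
    simp only [aFun, zero_mul, sub_zero, Real.sqrt_one, mul_one]
    ring


end Summit.KontsevichZagierPeriods.Grothendieck.GpcLegendreLemniscaticNegative
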